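import Mathlib
import HarnessLib

/-!
# CAP Instance B (cell pub-adcap) — a priori STABLE nearly integrable model with two crossing resonances: the certified drift CLAIM (statement level)

CITATION HEADER (lean-in-tree rule, cell pub-adcap, 2026-08-18). This module TYPES the exact statement that a
computer-assisted certificate for Instance B of the cell pub-adcap establishes, in the same house certificate pattern
as `…ArnoldDiffusionCAP.InstanceA`: literal vector field, a `Certificate` record of numbers, a `Prop`-valued claim,
nothing asserted. The concrete record `certB` (with the sha256 of the certificate file) is landed separately by the
numerics seats after two independent implementations agree.

The model is the a priori STABLE three-degree-of-freedom Hamiltonian of Froeschlé–Guzzo–Lega, DCDS-B 5 (2005) 687,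
eq. (1) [cite: FroeschleGuzzoLega2005, eq. (1)] (the system of their "first numerical evidence of global Arnold
diffusion in quasi-integrable systems"; their runs: `c = 1`, `ε = 0.01`):

  `H_ε(φ, I) = I₁²/2 + I₂²/2 + I₃ + ε / (cos φ₁ + cos φ₂ + cos φ₃ + 3 + c)`,   `φ ∈ 𝕋³`, `I ∈ ℝ³`, `c > 0`.

`H₀` is quasi-convex (KAM and Nekhoroshev apply for small `ε`), and hyperbolicity is born only from the resonances:
the Arnold web in the `(I₁, I₂)`-plane consists of the lines `k₁ I₁ + k₂ I₂ + k₃ = 0`; two of them cross at a DOUBLE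
resonance, which is the regime the cell's brief singles out. Angles are tracked on the cover `ℝ` (the vector field is
`2π`-periodic in each `φᵢ`; `φ₃` is the time-like angle, `φ₃' = 1`, so the system is autonomous `3` DOF ≡ `2½` DOF).

Prior art (HOME/FRESHNESS.md v1): NO validated (interval-arithmetic) diffusion result in an a priori stable model was
found in any engine on 2026-08-18 — the printed record for this model is numerical (FLI charts and long integrations).
The certificate is an INSTANCE (one system, one `c`, one `ε`-interval, one double resonance); it says nothing about
genericity and does not touch Mather's cusp-residual statement typed by the sibling cell pub-arnold.

PLACEMENT: as for Instance A, the brief's `Summits/ArnoldDiffusion/CAP/` is not an admissible gate target (no such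
summit; `Summits/` takes only `Statement` / `Theorems`), so the shape lives here as tracked Literature vocabulary.

What is deliberately NOT here: the flow object (a solution is a curve with `HasDerivAt`), resonance / NHIM / windows
vocabulary (the certificate's business, audited in HOME/REFEREE.md), and any numerical value.
-/

noncomputable section

open Set

namespace Literature.Dynamics.Hamiltonian.ArnoldDiffusionCAP.InstanceB

/-- Phase point `(φ₁, φ₂, φ₃, I₁, I₂, I₃) ∈ ℝ⁶` on the universal cover: indices `0,1,2` = angles, `3,4,5` = actions.
[folklore] -/
abbrev Pt := Fin 6 → ℝ

/-- The denominator `D(φ) = cos φ₁ + cos φ₂ + cos φ₃ + 3 + c` of the perturbation; `D ≥ c > 0` for `c > 0`.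
[cite: FroeschleGuzzoLega2005, eq. (1)] -/
def denom (c : ℝ) (x : Pt) : ℝ := Real.cos (x 0) + Real.cos (x 1) + Real.cos (x 2) + 3 + c

/-- The Hamiltonian `H_ε(φ, I) = I₁²/2 + I₂²/2 + I₃ + ε / D(φ)`. [cite: FroeschleGuzzoLega2005, eq. (1)] -/
def hamiltonian (c ε : ℝ) (x : Pt) : ℝ :=
  (x 3) ^ 2 / 2 + (x 4) ^ 2 / 2 + x 5 + ε / denom c x

/-- Hamilton's equations of `hamiltonian` as an explicit autonomous vector field on `ℝ⁶`:
`φ₁' = I₁`, `φ₂' = I₂`, `φ₃' = 1`, `Iᵢ' = −ε sin φᵢ / D(φ)²` (`i = 1, 2, 3`).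
[cite: FroeschleGuzzoLega2005, eq. (1)] -/
def vectorField (c ε : ℝ) (x : Pt) : Pt :=
  ![x 3, x 4, 1,
    -ε * Real.sin (x 0) / (denom c x) ^ 2,
    -ε * Real.sin (x 1) / (denom c x) ^ 2,
    -ε * Real.sin (x 2) / (denom c x) ^ 2]

/-- `γ : ℝ → ℝ⁶` is a (global, classical) solution of the Instance-B system at parameters `(c, ε)`. [folklore] -/
def IsSolution (c ε : ℝ) (γ : ℝ → Pt) : Prop :=
  ∀ t : ℝ, HasDerivAt γ (vectorField c ε (γ t)) t

/-- The DATA an Instance-B certificate summarises: the model constant `c`, the certified `ε`-interval, the initial box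
(on the cover), the certified action drift `deltaI` measured in the `(I₁, I₂)`-plane, the time bound, and the sha256
of the certificate file. No defaults (see `Claim` for why junk values make the claim false, not vacuous). [folklore] -/
structure Certificate where
  c : ℝ
  epsLo : ℝ
  epsHi : ℝ
  boxLo : Pt
  boxHi : Pt
  deltaI : ℝ
  timeBound : ℝ
  sha256 : String

/-- The initial box of a certificate, as a subset of `ℝ⁶`. [folklore] -/
def Certificate.box (c : Certificate) : Set Pt := {x | ∀ i, c.boxLo i ≤ x i ∧ x i ≤ c.boxHi i}

/-- Euclidean displacement in the `(I₁, I₂)`-plane between two phase points. [folklore] -/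
def actionDist (x y : Pt) : ℝ := Real.sqrt ((x 3 - y 3) ^ 2 + (x 4 - y 4) ^ 2)

/-- THE CLAIM of an Instance-B certificate `k` (statement level; nothing asserts it here): `0 < c`, `0 < epsLo ≤ epsHi`,
`0 < deltaI`, and for EVERY `ε ∈ [epsLo, epsHi]` there is a solution starting in the box whose `(I₁, I₂)` moves by at
least `deltaI` at some time `T ∈ [0, timeBound]`. Since `H₀` is quasi-convex, Nekhoroshev bounds `|I(t) − I(0)|` by
`a ε^{1/6}` for `|t| ≤ b exp((ε₀/ε)^{1/6})` [cite: FroeschleGuzzoLega2005, §2]; a certified `deltaI` of order one is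
therefore only meaningful together with its `timeBound`, which the record carries. [folklore] -/
def Claim (k : Certificate) : Prop :=
  0 < k.c ∧ 0 < k.epsLo ∧ k.epsLo ≤ k.epsHi ∧ 0 < k.deltaI ∧
  ∀ ε ∈ Icc k.epsLo k.epsHi, ∃ γ : ℝ → Pt, IsSolution k.c ε γ ∧ γ 0 ∈ k.box ∧
    ∃ T ∈ Icc (0 : ℝ) k.timeBound, k.deltaI ≤ actionDist (γ T) (γ 0)

/-- The DOUBLE-RESONANCE TRANSIT form: `target` is a second box (on the far side of the double resonance
`(k₁·I + k₃ = 0) ∩ (k₁'·I + k₃' = 0)` named in the certificate file); the claim is that for every `ε` in the interval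
some solution from the initial box enters `target` within the time bound. This is the statement the cell's brief calls
"two resonances crossing"; `Claim` follows from it whenever the two boxes are `deltaI` apart in `(I₁, I₂)`. [folklore] -/
def TransitClaim (k : Certificate) (targetLo targetHi : Pt) : Prop :=
  0 < k.c ∧ 0 < k.epsLo ∧ k.epsLo ≤ k.epsHi ∧
  ∀ ε ∈ Icc k.epsLo k.epsHi, ∃ γ : ℝ → Pt, IsSolution k.c ε γ ∧ γ 0 ∈ k.box ∧
    ∃ T ∈ Icc (0 : ℝ) k.timeBound, ∀ i, targetLo i ≤ γ T i ∧ γ T i ≤ targetHi i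

/-- Sanity (the only thing PROVED here): the denominator is bounded below by `c`, so the vector field is a genuine
smooth field for `c > 0` — no division by zero anywhere on the phase space. [cite: FroeschleGuzzoLega2005, eq. (1)] -/
theorem denom_ge (c : ℝ) (x : Pt) : c ≤ denom c x := by
  unfold denom
  have h0 := Real.neg_one_le_cos (x 0)
  have h1 := Real.neg_one_le_cos (x 1)
  have h2 := Real.neg_one_le_cos (x 2)
  linarith

/-- Sanity: `φ₃` is the time-like angle — its velocity is identically `1`. [cite: FroeschleGuzzoLega2005, eq. (1)] -/
theorem vectorField_two (c ε : ℝ) (x : Pt) : vectorField c ε x 2 = 1 := by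
  simp [vectorField]

/-- Sanity: a certificate whose claim holds has a positive model constant, a non-empty positive `ε`-interval and a
strictly positive drift (no vacuity). [folklore] -/
theorem Claim.pos {k : Certificate} (h : Claim k) : 0 < k.c ∧ 0 < k.epsLo ∧ 0 < k.deltaI :=
  ⟨h.1, h.2.1, h.2.2.2.1⟩

end Literature.Dynamics.Hamiltonian.ArnoldDiffusionCAP.InstanceB
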